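import Summits.QuantumFields.YangMills.Theorems.FemtoCutoffLadderThinning
import Literature.MathematicalPhysics.QuantumFieldTheory.TorusConfigShift
import Literature.MathematicalPhysics.QuantumFieldTheory.UnevenAxialBlocking
import HarnessLib

/-!
# Route `FemtoCutoffLadder` — HOLONOMIES PULL BACK EXACTLY under the thinning map, and the fine-translation average of the thinned coarse
# Polyakov-loop field is the fine Polyakov-loop field (exact kinematics behind the pinned engine `PinnedUpStep`, stmt-QuantumFields-26925)

Seat `ym-line-fcl-p3` g6 (2026-08-28).  Rung R2b1 = the RECORD-label femto transfer gap — NOT infinite volume, NOT the Clay mass gap; no summit and no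
step of the route is proved by this module.

Context.  The variational incommensurable step `UpStepEv` (stmt-QuantumFields-26796; fine gap ≤ coarse gap `+ CΛ²` for `L' < L < 2L'`) is engined by
`PinnedUpStep` (stmt-QuantumFields-26925, glue `upStepEv_of_pinnedUpStep`): the trial multiplier is the fine-translation AVERAGE
`f̄ = |Λ_L|⁻¹ Σ_v (φ'/Ω') ∘ thin L' ∘ τ_v` of the thinning pull-back of the coarse eigen-ratio (`Thinning.thin`, `FemtoCutoffLadderThinningDefs`;
`τ_v = TorusTranslation.torusConfigShift v`; kinematics `FemtoCutoffLadderThinningAveraged`).  The planner's spectral reading of that item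
(evidence `PUS_addendum2.md` on 26925, §B) rests on two EXACT intertwining identities, proved here for every dimension `d`, every monoid `G` and
every pair `L' ≤ L ≤ 2L'`:

* §1 `transport_torusConfigShift` — transporters of a translated configuration are translated transporters: `P_{τ_v U}(c; Γ) = P_U(c − v; Γ)`.
* §2 `transport_thin_replicate` — the coarse straight path of `k` links of direction `i` from `x'`, read on `thin L' U`, is the fine straight path of
  `Σ_{j<k} thinSteps (x'_i + j)` links from `thinSite x'` (the thinning paths of consecutive coarse links CONCATENATE, `thinSite_shift`);
  `sum_thinSteps_univ` / `sum_thinSteps_line` — along a full coarse circle the path lengths add up to the fine side `L`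
  (`2(L − L') + (2L' − L) = L`); whence ★ (H1) `transport_thin_line`: **the coarse Polyakov line (straight loop winding once around direction `i`)
  through `x'` of the thinned configuration IS the fine Polyakov line through `thinSite x'`** — holonomies of non-contractible straight loops pull
  back exactly, with no smearing and no remainder.
* §3 ★ (H2) `sum_shift_thin_loopSum` / `avg_thin_loopSum`: for EVERY function `f : G → M`, the fine-translation sum (average) of the thinned
  coarse loop sum `Σ_{x'} f(P_{thin(τ_v U)}(x'))` equals `|Λ_{L'}| · Σ_y f(P_U(y))` (resp. `(|Λ_{L'}|/|Λ_L|) · Σ_y f(P_U(y))`): the averaged thinning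
  pulls the coarse zero-momentum torelon field back to the fine zero-momentum torelon field EXACTLY (each fine line `y` is hit by exactly
  `|Λ_{L'}|` pairs `(v, x')` with `thinSite x' − v = y`).

These are the tree versions of the planner's sketch `Cruxes/…/HolonomyLemmas.lean` (H1 `transport_thin_line`, H2 `avg_thin_loopSum`, there sorried).
What is NOT here: anything about plaquettes (contractible loops do NOT pull back exactly — a thinned plaquette is a fine `1×1`, `1×2`, `2×1` or
`2×2` Wilson loop), anything about the fine or coarse DYNAMICS, any moment of `f̄` — that is the two-cutoff content of `PinnedUpStep` (barrier
`UVStabilityNonUniqueness`).  No definitions, no named facts, no `sorry`.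
-/

set_option autoImplicit false

namespace Summit.QuantumFields.YangMills.Theorems.FemtoTransferGap

open Literature.MathematicalPhysics.QuantumFieldTheory
open Literature.MathematicalPhysics.QuantumFieldTheory.TorusTranslation
open Literature.MathematicalPhysics.QuantumLattice (transport transport_cons transport_nil)

/-! ## §1 Parallel transport of translated configurations -/

/-- **Transporters of a translated configuration are translated transporters**: `P_{τ_v U}(c; Γ) = P_U(c − v; Γ)` for every path word `Γ`
(`(τ_v U)(x, i) = U(x − v, i)`). [folklore] -/
theorem transport_torusConfigShift {d L : ℕ} {G : Type*} [Monoid G] [MeasurableSpace G] (v : Site d L) (U : GaugeConfig d L G)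
    (c : Site d L) (is : List (Fin d)) :
    transport (torusConfigShift v U : GaugeConfig d L G) c is = transport U (c - v) is := by
  induction is generalizing c with
  | nil => simp only [transport_nil]
  | cons i is ih =>
    have hs : (c - v).shift i = c.shift i - v := by
      simp only [Site.shift]; abel
    rw [transport_cons, transport_cons, ih, torusConfigShift_apply, hs]

end Summit.QuantumFields.YangMills.Theorems.FemtoTransferGap

namespace Summit.QuantumFields.YangMills.Theorems.FemtoCutoffLadder.Thinning

open Literature.MathematicalPhysics.QuantumFieldTheory
open Literature.MathematicalPhysics.QuantumFieldTheory.TorusTranslation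
open Literature.MathematicalPhysics.QuantumLattice (transport transport_cons transport_nil pathEnd)
open Summit.QuantumFields.YangMills.Theorems.FemtoTransferGap

/-! ## §2 Straight coarse paths on the thinned configuration are straight fine paths -/

section Line

variable {d L L' : ℕ} [NeZero L'] {G : Type*} [Monoid G]

/-- **Thinning paths concatenate**: the coarse straight path of `k` links of direction `i` from `x'`, evaluated on `thin L' U`, is the fine
straight path of `Σ_{j<k} thinSteps (x'_i + j)` links of direction `i` from `thinSite x'` (induction on `k`: the path of the coarse link
`(x', i)` ends at `thinSite (x' + eᵢ)`, `thinSite_shift`; then `transport_append`). [folklore] -/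
theorem transport_thin_replicate (hLL : L' ≤ L) (h2 : L ≤ 2 * L') (U : GaugeConfig d L G) (i : Fin d) (k : ℕ) (x' : Site d L') :
    transport (thin L' U) x' (List.replicate k i) =
      transport U (thinSite L x') (List.replicate (∑ j ∈ Finset.range k, thinSteps L L' (x' i + (j : ℕ))) i) := by
  induction k generalizing x' with
  | zero => simp only [List.replicate_zero, transport_nil, Finset.range_zero, Finset.sum_empty]
  | succ k ih =>
    have hshift : (x'.shift i) i = x' i + 1 := by
      simp only [Site.shift, Pi.add_apply, Pi.single_eq_same]
    have hsum : ∑ j ∈ Finset.range (k + 1), thinSteps L L' (x' i + (j : ℕ)) =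
        thinSteps L L' (x' i) + ∑ j ∈ Finset.range k, thinSteps L L' ((x'.shift i) i + (j : ℕ)) := by
      rw [Finset.sum_range_succ', Nat.cast_zero, add_zero, add_comm, hshift]
      refine congrArg _ (Finset.sum_congr rfl fun j _ => ?_)
      rw [Nat.cast_succ, add_assoc, add_comm (1 : ZMod L') (j : ZMod L')]
    rw [List.replicate_succ, transport_cons, ih (x'.shift i), hsum, List.replicate_add, transport_append,
      ← thinSite_shift hLL h2 x' i]
    rfl

/-- Sums over `ℤ/n` of a function of the representative are sums over `{0, …, n−1}`. [folklore] -/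
theorem sum_univ_zmod_val {M : Type*} [AddCommMonoid M] (n : ℕ) [NeZero n] (h : ℕ → M) :
    ∑ b : ZMod n, h b.val = ∑ j ∈ Finset.range n, h j := by
  rw [← Fin.sum_univ_eq_sum_range]
  refine (Fintype.sum_bijective (fun t : Fin n => ((t : ℕ) : ZMod n)) ?_ (fun t => h t) (fun b => h b.val) fun t => ?_).symm
  · refine (Fintype.bijective_iff_injective_and_card _).2 ⟨fun s t hst => ?_, by simp [ZMod.card]⟩
    have hv := congrArg ZMod.val hst
    simp only [ZMod.val_natCast_of_lt s.2, ZMod.val_natCast_of_lt t.2] at hv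
    exact Fin.ext hv
  · simp only [ZMod.val_natCast_of_lt t.2]

/-- **The thinning path lengths tile the fine circle**: `Σ_{a ∈ ℤ/L'} thinSteps a = 2(L − L') + (L' − (L − L')) = L` for `L' ≤ L ≤ 2L'`. [folklore] -/
theorem sum_thinSteps_univ (hLL : L' ≤ L) (h2 : L ≤ 2 * L') : ∑ a : ZMod L', thinSteps L L' a = L := by
  have h := sum_univ_zmod_val (M := ℕ) L' (fun j => if j < L - L' then 2 else 1)
  have hth : (fun a : ZMod L' => thinSteps L L' a) = fun a : ZMod L' => if a.val < L - L' then 2 else 1 := rfl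
  rw [hth, h]
  have key : ∀ n : ℕ, ∑ j ∈ Finset.range n, (if j < L - L' then 2 else 1) = n + min (L - L') n := by
    intro n
    induction n with
    | zero => simp
    | succ n ih =>
      rw [Finset.sum_range_succ, ih]
      split_ifs with hn <;> omega
  rw [key]
  omega

/-- The same sum read along the coarse line from any starting coordinate `a`: `Σ_{j<L'} thinSteps (a + j) = L`. [folklore] -/
theorem sum_thinSteps_line (hLL : L' ≤ L) (h2 : L ≤ 2 * L') (a : ZMod L') :
    ∑ j ∈ Finset.range L', thinSteps L L' (a + (j : ℕ)) = L := by
  have h1 : ∑ j ∈ Finset.range L', thinSteps L L' (a + (j : ℕ)) = ∑ b : ZMod L', thinSteps L L' (a + ((b.val : ℕ) : ZMod L')) :=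
    (sum_univ_zmod_val (M := ℕ) L' (fun j => thinSteps L L' (a + (j : ℕ)))).symm
  rw [h1]
  simp only [ZMod.natCast_zmod_val]
  rw [show ∑ b : ZMod L', thinSteps L L' (a + b) = ∑ b : ZMod L', thinSteps L L' b from
    Equiv.sum_comp (Equiv.addLeft a) (fun b => thinSteps L L' b)]
  exact sum_thinSteps_univ hLL h2

/-- ★ (H1) **Holonomies pull back exactly under thinning**: the coarse Polyakov line — the straight loop of `L'` links of direction `i` winding once
around the coarse torus from `x'` — evaluated on the thinned configuration `thin L' U` equals the fine Polyakov line of `L` links of direction `i`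
from `thinSite x'` (the thinning paths along a full coarse circle concatenate to the full fine circle). [folklore] -/
theorem transport_thin_line (hLL : L' ≤ L) (h2 : L ≤ 2 * L') (U : GaugeConfig d L G) (x' : Site d L') (i : Fin d) :
    transport (thin L' U) x' (List.replicate L' i) = transport U (thinSite L x') (List.replicate L i) := by
  rw [transport_thin_replicate hLL h2 U i L' x', sum_thinSteps_line hLL h2 (x' i)]

end Line

/-! ## §3 The fine-translation average of the thinned coarse loop field is the fine loop field -/

section LoopSum

variable {d L L' : ℕ} [NeZero L] [NeZero L'] {G : Type*} [Monoid G] [MeasurableSpace G]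

/-- ★ (H2, integer form) **Averaged loop sums are exact**: for every `f : G → M`, summing the thinned coarse loop sum
`Σ_{x'} f(P_{thin L' (τ_v U)}(x'; i))` over all fine translations `v ∈ (ℤ/L)^d` gives `|Λ_{L'}| · Σ_y f(P_U(y; i))`: by (H1) and
`transport_torusConfigShift` the `(v, x')` term is `f` of the fine line through `thinSite x' − v`, and for each `x'` the map `v ↦ thinSite x' − v` is a
bijection of the fine sites. [folklore] -/
theorem sum_shift_thin_loopSum {M : Type*} [AddCommMonoid M] (hLL : L' ≤ L) (h2 : L ≤ 2 * L') (f : G → M) (U : GaugeConfig d L G)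
    (i : Fin d) :
    ∑ v : Site d L, ∑ x' : Site d L', f (transport (thin L' (torusConfigShift v U : GaugeConfig d L G)) x' (List.replicate L' i)) =
      Fintype.card (Site d L') • ∑ y : Site d L, f (transport U y (List.replicate L i)) := by
  have hterm : ∀ (v : Site d L) (x' : Site d L'),
      f (transport (thin L' (torusConfigShift v U : GaugeConfig d L G)) x' (List.replicate L' i)) =
        f (transport U (thinSite L x' - v) (List.replicate L i)) := by
    intro v x'
    rw [transport_thin_line hLL h2, transport_torusConfigShift]
  simp only [hterm]
  rw [Finset.sum_comm]
  have hinner : ∀ x' : Site d L', ∑ v : Site d L, f (transport U (thinSite L x' - v) (List.replicate L i)) =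
      ∑ y : Site d L, f (transport U y (List.replicate L i)) := fun x' =>
    Equiv.sum_comp (Equiv.subLeft (thinSite L x')) (fun y => f (transport U y (List.replicate L i)))
  simp only [hinner, Finset.sum_const, Finset.card_univ]

/-- ★ (H2) **The fine-translation AVERAGE of the thinned coarse Polyakov-loop field is the fine Polyakov-loop field, exactly**:
`|Λ_L|⁻¹ Σ_v Σ_{x'} f(P_{thin L' (τ_v U)}(x'; i)) = (|Λ_{L'}| / |Λ_L|) · Σ_y f(P_U(y; i))` for every real observable `f` of the line holonomy —
equivalently, per-site DENSITIES agree: `|Λ_L|⁻¹ Σ_v [|Λ_{L'}|⁻¹ Σ_{x'} f(P_{thin(τ_v U)}(x'))] = |Λ_L|⁻¹ Σ_y f(P_U(y))`.  The averaged thinning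
pull-back carries the coarse zero-momentum torelon field to the fine one with no aliasing remainder. [folklore] -/
theorem avg_thin_loopSum (hLL : L' ≤ L) (h2 : L ≤ 2 * L') (f : G → ℝ) (U : GaugeConfig d L G) (i : Fin d) :
    (Fintype.card (Site d L) : ℝ)⁻¹ *
        ∑ v : Site d L, ∑ x' : Site d L', f (transport (thin L' (torusConfigShift v U : GaugeConfig d L G)) x' (List.replicate L' i)) =
      ((Fintype.card (Site d L') : ℝ) / Fintype.card (Site d L)) * ∑ y : Site d L, f (transport U y (List.replicate L i)) := by
  rw [sum_shift_thin_loopSum hLL h2 f U i, nsmul_eq_mul, div_eq_mul_inv]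
  ring

/-- (H2, density form) `|Λ_L|⁻¹ Σ_v |Λ_{L'}|⁻¹ Σ_{x'} f(P_{thin(τ_v U)}(x'; i)) = |Λ_L|⁻¹ Σ_y f(P_U(y; i))`: the translation average of the thinned
coarse loop DENSITY is the fine loop density. [folklore] -/
theorem avg_thin_loopDensity (hLL : L' ≤ L) (h2 : L ≤ 2 * L') (f : G → ℝ) (U : GaugeConfig d L G) (i : Fin d) :
    (Fintype.card (Site d L) : ℝ)⁻¹ * ∑ v : Site d L,
        ((Fintype.card (Site d L') : ℝ)⁻¹ *
          ∑ x' : Site d L', f (transport (thin L' (torusConfigShift v U : GaugeConfig d L G)) x' (List.replicate L' i))) =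
      (Fintype.card (Site d L) : ℝ)⁻¹ * ∑ y : Site d L, f (transport U y (List.replicate L i)) := by
  have hc' : (Fintype.card (Site d L') : ℝ) ≠ 0 := by exact_mod_cast Fintype.card_ne_zero
  rw [← Finset.mul_sum, sum_shift_thin_loopSum hLL h2 f U i, nsmul_eq_mul, inv_mul_cancel_left₀ hc']

end LoopSum

end Summit.QuantumFields.YangMills.Theorems.FemtoCutoffLadder.Thinning
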